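import Summits.HodgeConjecture.HodgeConjecture.Theorems.ELineTransportELineConnectivityRChain
import Summits.HodgeConjecture.HodgeConjecture.Theorems.ELineTransportELineConnectivityRField

/-!
# Route `ELineTransport` — support item `ELineConnectivityR` (stmt-HodgeConjecture-13981), part 6:
# the node of a generic positive plane

`exists_node`: for an E-structure `Jm` (`Jm² = m`, `m` a non-square, `D`-self-adjoint) and a
positive definite pair `(u, v')` of real `(+√m)`-eigenvectors of `Jm` whose WITNESS `u` is
GENERIC — not `D`-orthogonal to any non-zero rational vector, and outside the countably many
CM planes `Q(θ, k) = ⟨Re y, Im y⟩` (`y` a chosen `μ_k(θ)`-eigenvector of the rational matrix `θ`,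
`μ_k(θ)` the `k`-th complex root of its characteristic polynomial) — the period vector
`x = u + iv` of the plane (part 2) satisfies ALL node conditions of
`Theses.ELineTransport.ELineConnectivityR`: `Jm x = √m x`, `x·x = 0`, `x̄·x > 0`, `Re x = u`,
`Im x ∈ ⟨u, v'⟩`, `NS(x) = 0`, and `End_Hdg(x) = ℚ + ℚ Jm` — the last by Schur (part 3) and the
degree dichotomy (part 4): if `End_Hdg(x) ≠ ℚ + ℚ Jm` then `ℂx` is an eigenline of some rational
`θ`, so `u = Re x` lies in the CM plane of `(θ, k)` for the index `k` of its eigenvalue.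
No definitions, no named facts, no sorry.
-/

-- `Summit.HodgeConjecture.HodgeConjecture.…` (summit = problem) duplicates a namespace component by design (D-0017).
set_option linter.dupNamespace false

noncomputable section

open Matrix Module

namespace Summit.HodgeConjecture.HodgeConjecture.Theorems

namespace ELineConnR

local notation3 "Dℝ" => (Matrix.diagonal (fun i : Fin 22 => if i.val < 3 then (1 : ℝ) else -1))
local notation3 "Dℂ" => (Matrix.diagonal (fun i : Fin 22 => if i.val < 3 then (1 : ℂ) else -1))

/-- The Hodge endomorphisms of a period vector `x` (eigenvector `x`, preserving `{x, x̄}^⊥`) form a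
`ℚ`-subalgebra of `M₂₂(ℚ)`: closure properties. [folklore] -/
theorem hodgeEnd_closure (x : Fin 22 → ℂ) :
    ∃ R : Subalgebra ℚ (Matrix (Fin 22) (Fin 22) ℚ), ∀ A : Matrix (Fin 22) (Fin 22) ℚ, A ∈ R ↔
      ((∃ c : ℂ, (A.map (fun t : ℚ => (t : ℂ))) *ᵥ x = c • x) ∧
        ∀ v : Fin 22 → ℂ, v ⬝ᵥ (Dℂ *ᵥ x) = 0 → v ⬝ᵥ (Dℂ *ᵥ (star x)) = 0 →
          ((A.map (fun t : ℚ => (t : ℂ))) *ᵥ v) ⬝ᵥ (Dℂ *ᵥ x) = 0 ∧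
          ((A.map (fun t : ℚ => (t : ℂ))) *ᵥ v) ⬝ᵥ (Dℂ *ᵥ (star x)) = 0) := by
  have hmap_add : ∀ A B : Matrix (Fin 22) (Fin 22) ℚ, (A + B).map (fun t : ℚ => (t : ℂ)) =
      A.map (fun t : ℚ => (t : ℂ)) + B.map (fun t : ℚ => (t : ℂ)) := fun A B =>
    Matrix.map_add _ (fun a b => Rat.cast_add a b) A B
  have hmap_alg : ∀ r : ℚ, (algebraMap ℚ (Matrix (Fin 22) (Fin 22) ℚ) r).map
      (fun t : ℚ => (t : ℂ)) = algebraMap ℂ (Matrix (Fin 22) (Fin 22) ℂ) (r : ℂ) := by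
    intro r
    ext i j
    rw [Matrix.map_apply, Matrix.algebraMap_matrix_apply, Matrix.algebraMap_matrix_apply]
    split_ifs <;> simp
  set P : Matrix (Fin 22) (Fin 22) ℚ → Prop := fun A =>
    (∃ c : ℂ, (A.map (fun t : ℚ => (t : ℂ))) *ᵥ x = c • x) ∧
      ∀ v : Fin 22 → ℂ, v ⬝ᵥ (Dℂ *ᵥ x) = 0 → v ⬝ᵥ (Dℂ *ᵥ (star x)) = 0 →
        ((A.map (fun t : ℚ => (t : ℂ))) *ᵥ v) ⬝ᵥ (Dℂ *ᵥ x) = 0 ∧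
        ((A.map (fun t : ℚ => (t : ℂ))) *ᵥ v) ⬝ᵥ (Dℂ *ᵥ (star x)) = 0 with hP
  refine ⟨{ carrier := setOf P, mul_mem' := ?_, one_mem' := ?_, add_mem' := ?_, zero_mem' := ?_,
            algebraMap_mem' := ?_ }, fun A => Iff.rfl⟩
  · rintro A B ⟨⟨a, ha⟩, hA⟩ ⟨⟨b, hb⟩, hB⟩
    refine ⟨⟨a * b, ?_⟩, ?_⟩
    · rw [ratMap_mul_mulVec, hb, Matrix.mulVec_smul, ha, smul_smul, mul_comm]
    · intro v hv1 hv2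
      rw [ratMap_mul_mulVec]
      obtain ⟨h1, h2⟩ := hB v hv1 hv2
      exact hA _ h1 h2
  · refine ⟨⟨1, ?_⟩, ?_⟩
    · rw [ratMap_one, Matrix.one_mulVec, one_smul]
    · intro v hv1 hv2
      rw [ratMap_one, Matrix.one_mulVec]
      exact ⟨hv1, hv2⟩
  · rintro A B ⟨⟨a, ha⟩, hA⟩ ⟨⟨b, hb⟩, hB⟩
    refine ⟨⟨a + b, ?_⟩, ?_⟩
    · rw [hmap_add, Matrix.add_mulVec, ha, hb, add_smul]
    · intro v hv1 hv2
      obtain ⟨h1, h2⟩ := hA v hv1 hv2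
      obtain ⟨h3, h4⟩ := hB v hv1 hv2
      rw [hmap_add, Matrix.add_mulVec, add_dotProduct, add_dotProduct, h1, h2, h3, h4, add_zero]
      exact ⟨rfl, rfl⟩
  · refine ⟨⟨0, ?_⟩, ?_⟩
    · rw [Matrix.map_zero _ (by simp), Matrix.zero_mulVec, zero_smul]
    · intro v hv1 hv2
      rw [Matrix.map_zero _ (by simp), Matrix.zero_mulVec, zero_dotProduct, zero_dotProduct]
      exact ⟨rfl, rfl⟩
  · intro r
    refine ⟨⟨(r : ℂ), ?_⟩, ?_⟩
    · rw [hmap_alg, Algebra.algebraMap_eq_smul_one, Matrix.smul_mulVec, Matrix.one_mulVec]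
    · intro v hv1 hv2
      rw [hmap_alg, Algebra.algebraMap_eq_smul_one, Matrix.smul_mulVec, Matrix.one_mulVec,
        smul_dotProduct, smul_dotProduct, hv1, hv2, smul_zero]
      exact ⟨rfl, rfl⟩

/-- Real and imaginary parts of a complex multiple lie in the real span of the real and imaginary
parts. [folklore] -/
theorem re_smul_mem_span (c : ℂ) (y : Fin 22 → ℂ) :
    (fun j => ((c • y) j).re) ∈ Submodule.span ℝ
      ({fun j => (y j).re, fun j => (y j).im} : Set (Fin 22 → ℝ)) := by
  have h : (fun j => ((c • y) j).re) = c.re • (fun j => (y j).re) + (-c.im) • (fun j => (y j).im) := by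
    funext j
    simp only [Pi.smul_apply, smul_eq_mul, Complex.mul_re, Pi.add_apply, neg_mul]
    ring
  rw [h]
  exact mem_span_pair_of_comb _ _

/-- **The node of a generic positive plane.** See the module docstring. [folklore] -/
theorem exists_node {m : ℕ} (hm : ¬ IsSquare m) {Jm : Matrix (Fin 22) (Fin 22) ℚ}
    (hJ2 : Jm * Jm = (m : ℚ) • (1 : Matrix (Fin 22) (Fin 22) ℚ))
    (hJsa : Jm.transpose * Matrix.diagonal (fun i : Fin 22 => if i.val < 3 then (1 : ℚ) else -1) =
      Matrix.diagonal (fun i : Fin 22 => if i.val < 3 then (1 : ℚ) else -1) * Jm)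
    {u v' : Fin 22 → ℝ}
    (hu : (Jm.map (fun t : ℚ => (t : ℝ))) *ᵥ u = Real.sqrt m • u)
    (hv' : (Jm.map (fun t : ℚ => (t : ℝ))) *ᵥ v' = Real.sqrt m • v')
    (hP : ∀ a b : ℝ, (a ≠ 0 ∨ b ≠ 0) → 0 < (a • u + b • v') ⬝ᵥ (Dℝ *ᵥ (a • u + b • v')))
    (hNS : ∀ l : Fin 22 → ℚ, l ≠ 0 → (fun j => ((l j : ℚ) : ℝ)) ⬝ᵥ (Dℝ *ᵥ u) ≠ 0)
    (Q : Matrix (Fin 22) (Fin 22) ℚ × ℕ → Submodule ℝ (Fin 22 → ℝ))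
    (hQ : ∀ p, Q p = Submodule.span ℝ
      ({fun j => (Classical.epsilon (fun y : Fin 22 → ℂ => y ≠ 0 ∧
          (p.1.map (fun t : ℚ => (t : ℂ))) *ᵥ y =
            (((p.1.map (fun t : ℚ => (t : ℂ))).charpoly.roots.toList.getD p.2 0) • y)) j).re,
        fun j => (Classical.epsilon (fun y : Fin 22 → ℂ => y ≠ 0 ∧
          (p.1.map (fun t : ℚ => (t : ℂ))) *ᵥ y =
            (((p.1.map (fun t : ℚ => (t : ℂ))).charpoly.roots.toList.getD p.2 0) • y)) j).im} :
        Set (Fin 22 → ℝ)))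
    (hCM : ∀ p, u ∉ Q p) :
    ∃ x : Fin 22 → ℂ,
      (Jm.map (fun t : ℚ => (t : ℂ))) *ᵥ x = (Real.sqrt m : ℂ) • x ∧
      x ⬝ᵥ (Dℂ *ᵥ x) = 0 ∧
      0 < ((star x) ⬝ᵥ (Dℂ *ᵥ x)).re ∧
      (fun j => (x j).re) = u ∧
      (fun j => (x j).im) ∈ Submodule.span ℝ ({u, v'} : Set (Fin 22 → ℝ)) ∧
      (∀ l : Fin 22 → ℚ, (fun j => (l j : ℂ)) ⬝ᵥ (Dℂ *ᵥ x) = 0 → l = 0) ∧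
      (∀ A : Matrix (Fin 22) (Fin 22) ℚ,
        (∃ c : ℂ, (A.map (fun t : ℚ => (t : ℂ))) *ᵥ x = c • x) →
        (∀ v : Fin 22 → ℂ, v ⬝ᵥ (Dℂ *ᵥ x) = 0 → v ⬝ᵥ (Dℂ *ᵥ (star x)) = 0 →
          ((A.map (fun t : ℚ => (t : ℂ))) *ᵥ v) ⬝ᵥ (Dℂ *ᵥ x) = 0 ∧
          ((A.map (fun t : ℚ => (t : ℂ))) *ᵥ v) ⬝ᵥ (Dℂ *ᵥ (star x)) = 0) →
        ∃ a b : ℚ, A = a • (1 : Matrix (Fin 22) (Fin 22) ℚ) + b • Jm) := by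
  obtain ⟨v, hvspan, -, hxx, hxpos, hNS'⟩ := exists_periodVector u v' hP
  set x : Fin 22 → ℂ := fun j => (⟨u j, v j⟩ : ℂ) with hx
  -- `v` is again a `√m`-eigenvector
  have hv : (Jm.map (fun t : ℚ => (t : ℝ))) *ᵥ v = Real.sqrt m • v := by
    obtain ⟨a, b, hab⟩ := Submodule.mem_span_pair.1 hvspan
    rw [← hab, Matrix.mulVec_add, Matrix.mulVec_smul, Matrix.mulVec_smul, hu, hv', smul_add,
      smul_comm a, smul_comm b]
  have hJx : (Jm.map (fun t : ℚ => (t : ℂ))) *ᵥ x = (Real.sqrt m : ℂ) • x :=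
    mulVec_mk_mk_of_real Jm (Real.sqrt m) u v hu hv
  have hxb : (star x) ⬝ᵥ (Dℂ *ᵥ x) ≠ 0 := by
    intro h; rw [h] at hxpos; simp at hxpos
  have hx0 : x ≠ 0 := by
    intro h; apply hxb; rw [h]; simp
  -- `NS(x) = 0`
  have hNSx : ∀ l : Fin 22 → ℚ, (fun j => (l j : ℂ)) ⬝ᵥ (Dℂ *ᵥ x) = 0 → l = 0 := by
    intro l hl
    by_contra hl0
    have hcast : (fun j => (l j : ℂ)) = fun j => (((l j : ℚ) : ℝ) : ℂ) := by
      funext j; push_cast; rfl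
    rw [hcast] at hl
    exact hNS l hl0 (hNS' _ hl).1
  refine ⟨x, hJx, hxx, hxpos, rfl, hvspan, hNSx, ?_⟩
  -- `End_Hdg(x) = ℚ + ℚ Jm`
  intro A hAx hAH
  obtain ⟨R, hR⟩ := hodgeEnd_closure x
  have hJR : Jm ∈ R := (hR Jm).2 ⟨⟨_, hJx⟩, jm_hodgeEnd Jm hJsa (Real.sqrt m) hJx⟩
  have hev : ∀ B ∈ R, ∃ c : ℂ, (B.map (fun t : ℚ => (t : ℂ))) *ᵥ x = c • x :=
    fun B hB => ((hR B).1 hB).1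
  have h0 : ∀ B ∈ R, (B.map (fun t : ℚ => (t : ℂ))) *ᵥ x = 0 → B = 0 :=
    fun B _ hB => eq_zero_of_mulVec_eq_zero hNSx hB
  have hunit : ∀ B ∈ R, B ≠ 0 → IsUnit B ∧ B⁻¹ ∈ R := by
    intro B hB hB0
    obtain ⟨⟨c, hc⟩, hBH⟩ := (hR B).1 hB
    have hu := isUnit_of_hodgeEnd hxx hxb hNSx hB0 hc hBH
    exact ⟨hu, (hR _).2 (inv_hodgeEnd hxx hxb hNSx hu hc hBH)⟩
  rcases hodgeAlg_dichotomy hm hJ2 R hJR hx0 hev h0 hunit with hgood | ⟨θ, -, μ, hθx, heig⟩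
  · exact hgood A ((hR A).2 ⟨hAx, hAH⟩)
  · exfalso
    -- `μ` is the `k`-th root of the characteristic polynomial for some `k`
    have hμ := mem_roots_charpoly_of_eigen θ hx0 hθx
    rw [← Multiset.mem_toList] at hμ
    obtain ⟨k, hk, hμk⟩ := List.mem_iff_getElem.1 hμ
    have hgetD : ((θ.map (fun t : ℚ => (t : ℂ))).charpoly.roots.toList.getD k 0) = μ := by
      rw [List.getD_eq_getElem _ _ hk, hμk]
    -- the chosen eigenvector `y` of `(θ, k)` is a multiple of `x`
    set y : Fin 22 → ℂ := Classical.epsilon (fun y : Fin 22 → ℂ => y ≠ 0 ∧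
      (θ.map (fun t : ℚ => (t : ℂ))) *ᵥ y =
        (((θ.map (fun t : ℚ => (t : ℂ))).charpoly.roots.toList.getD k 0) • y)) with hy
    have hyspec : y ≠ 0 ∧ (θ.map (fun t : ℚ => (t : ℂ))) *ᵥ y =
        (((θ.map (fun t : ℚ => (t : ℂ))).charpoly.roots.toList.getD k 0) • y) :=
      Classical.epsilon_spec (p := fun y : Fin 22 → ℂ => y ≠ 0 ∧
        (θ.map (fun t : ℚ => (t : ℂ))) *ᵥ y =
          (((θ.map (fun t : ℚ => (t : ℂ))).charpoly.roots.toList.getD k 0) • y))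
        ⟨x, hx0, by rw [hgetD]; exact hθx⟩
    rw [hgetD] at hyspec
    obtain ⟨c, hc⟩ := heig y hyspec.2
    have hc0 : c ≠ 0 := by
      rintro rfl
      exact hyspec.1 (by rw [hc, zero_smul])
    -- so `u = Re x = Re (c⁻¹ y)` lies in the CM plane of `(θ, k)`
    apply hCM (θ, k)
    rw [hQ]
    have hxy : x = c⁻¹ • y := by rw [hc, smul_smul, inv_mul_cancel₀ hc0, one_smul]
    have hu_eq : u = fun j => ((c⁻¹ • y) j).re := by
      rw [← hxy]
    rw [hu_eq]
    exact re_smul_mem_span c⁻¹ y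

end ELineConnR

end Summit.HodgeConjecture.HodgeConjecture.Theorems

end
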